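import Literature.Topology.FourManifolds.SurfaceCapping
import Literature.Topology.FourManifolds.SmoothOrientationGluing
import Literature.Topology.FourManifolds.SmoothOrientationConnectedProofs
import Literature.Topology.FourManifolds.SpinDiffeomorphProofs
import Literature.Topology.FourManifolds.SpinProofs
import Literature.Topology.FourManifolds.ImmersionOrientation
import Literature.Topology.FourManifolds.BallRemovalCobordism
import Literature.Topology.FourManifolds.SeifertCircleMap
import HarnessLib

/-!
# The capped surface is orientable

Topic `Literature/Topology/FourManifolds`; fact seat
`provefact-Literature.Topology.FourManifolds.Knot.sliceGenus_eq_zero_iff`, leaf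
`Literature.Topology.FourManifolds.even_finrank_singularHomology_one_of_boundary_circle`.
Sequel to `SurfaceCapping.lean`: the capped surface `P = S ∪_φ 𝔻²` of a compact **orientable**
surface `S` with one boundary circle is orientable (Hirsch, *Differential Topology* (1976), Ch. 9
§3, proof of Thm. 3.7: the closed surface obtained by attaching discs to an orientable surface is
orientable; Kosinski, *Differential Manifolds* (1993), VI.(1.1) for the orientation of a gluing).

The tree's gluing `P` is the iterated open gluing `((∂S × ℝ) ∪ (S ∖ ∂S)) ∪ (𝔻² ∖ ∂𝔻²)`
(`BoundaryGluingConstruction.lean`), so orientability is obtained twice from: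

* `IsOrientable.of_opens_cover_of_isPreconnected` — **a manifold covered by two orientable open
  submanifolds with (pre)connected intersection is orientable**: on the connected overlap the two
  restricted orientations agree or are opposite (`SmoothOrientation.eq_or_eq_neg_of_connectedSpace`,
  Hirsch §4.4), so after possibly reversing one of them they glue (`SmoothOrientation.glue`);

the pieces being orientable as diffeomorphic (equal model vector space `ℝ²`) to orientable
manifolds: the cylinder piece to the punctured plane (`polarDiffeomorph : ℝ² ∖ 0 ≅ 𝕊¹ × ℝ`), the
other pieces to the interiors of `S` and of `𝔻²` (orientable with `S`, `𝔻²`, by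
`IsOrientable.of_isSmoothEmbedding` along the interior inclusion); the overlaps are images of
`∂S × (0, ∞)` and `∂S × (-∞, 0)`, connected since `∂S ≅ 𝕊¹` is.

## Main results

* `SmoothOrientation.restrictLE`, `IsOrientable.of_opens_cover_of_isPreconnected` (general);
* `polarDiffeomorph`, `isOrientable_puncturedPlane`;
* `CapData.isOrientable_X` (the first glued manifold), **`CapData.isOrientable_P`**.

## References

* M. W. Hirsch, *Differential Topology*, GTM 33 (1976), §4.4 and Ch. 9 §3 Thm. 3.7. [HirschDT1976]
* A. Kosinski, *Differential Manifolds* (1993), Ch. VI §1, (1.1). [Kosinski1993]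
-/

noncomputable section

open Set Function
open scoped Manifold ContDiff Topology

namespace Literature.Topology.FourManifolds

/-- Local notation: `𝔼 n` is the model Euclidean space `EuclideanSpace ℝ (Fin n)`. -/
local notation "𝔼 " n:arg => EuclideanSpace ℝ (Fin n)

/-- Local notation: `𝕊 n` is the unit sphere in `EuclideanSpace ℝ (Fin (n + 1))`. -/
local notation "𝕊 " n:arg => (Metric.sphere (0 : EuclideanSpace ℝ (Fin (n + 1))) 1)

/-- Local notation: `𝔻 n` is the closed unit ball in `EuclideanSpace ℝ (Fin n)`. -/
local notation "𝔻 " n:arg => (Metric.closedBall (0 : EuclideanSpace ℝ (Fin n)) 1)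

/-! ### Orientations: restriction to smaller opens; gluing over a connected overlap -/

section Cover

variable {E H : Type*} [NormedAddCommGroup E] [NormedSpace ℝ E] [TopologicalSpace H]
  {I : ModelWithCorners ℝ E H} {M : Type*} [TopologicalSpace M] [ChartedSpace H M]
  [IsManifold I 1 M]

/-- **Restriction of a smooth orientation of an open submanifold `U` to a smaller open `W ≤ U`**
(the charts of both are restrictions of the charts of `M`, so the tangent coordinate changes
agree, `TopologicalSpace.Opens.tangentCoordChange_coe`; Hirsch, *Differential Topology*, §4.4).
[folklore] -/
def SmoothOrientation.restrictLE {U W : TopologicalSpace.Opens M} (h : W ≤ U)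
    (o : SmoothOrientation I U) : SmoothOrientation I W where
  toFun w := o ⟨w.1, h w.2⟩
  eventually_eq_iff' w := by
    have hι : Continuous fun w : W => (⟨w.1, h w.2⟩ : U) :=
      continuous_subtype_val.subtype_mk _
    filter_upwards [hι.continuousAt.eventually (o.eventually_eq_iff ⟨w.1, h w.2⟩)] with y hy
    rw [TopologicalSpace.Opens.tangentCoordChange_coe W (mem_chart_source H y)]
    rw [TopologicalSpace.Opens.tangentCoordChange_coe U (mem_chart_source H (⟨y.1, h y.2⟩ : U))]
      at hy
    exact hy

/-- Value of the restricted orientation. [folklore] -/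
@[simp] theorem SmoothOrientation.restrictLE_apply {U W : TopologicalSpace.Opens M} (h : W ≤ U)
    (o : SmoothOrientation I U) (w : W) : o.restrictLE h w = o ⟨w.1, h w.2⟩ := rfl

/-- **A manifold covered by two orientable open submanifolds with preconnected intersection is
orientable**: on the overlap the two restricted orientations agree or are opposite (Hirsch,
*Differential Topology* (1976), §4.4: a connected orientable manifold has exactly two
orientations; `SmoothOrientation.eq_or_eq_neg_of_connectedSpace`), and after reversing one of
them if necessary they glue (`SmoothOrientation.glue`; Kosinski 1993, VI.(1.1)).
[cite: HirschDT1976, Ch. 4 §4] -/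
theorem IsOrientable.of_opens_cover_of_isPreconnected (U V : TopologicalSpace.Opens M)
    (hcover : ∀ x, x ∈ U ∨ x ∈ V) (hU : IsOrientable I U) (hV : IsOrientable I V)
    (hconn : IsPreconnected ((U : Set M) ∩ V)) : IsOrientable I M := by
  obtain ⟨oU⟩ := hU
  obtain ⟨oV⟩ := hV
  rcases ((U : Set M) ∩ V).eq_empty_or_nonempty with hW | hW
  · refine ⟨SmoothOrientation.glue U V oU oV hcover fun x hxU hxV => ?_⟩
    have : x ∈ (U : Set M) ∩ V := ⟨hxU, hxV⟩
    rw [hW] at this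
    exact absurd this (notMem_empty x)
  · haveI : ConnectedSpace ↥(U ⊓ V) := isConnected_iff_connectedSpace.1 ⟨hW, hconn⟩
    rcases SmoothOrientation.eq_or_eq_neg_of_connectedSpace_holds
      (oU.restrictLE (inf_le_left : U ⊓ V ≤ U)) (oV.restrictLE (inf_le_right : U ⊓ V ≤ V))
      with h | h
    · refine ⟨SmoothOrientation.glue U V oU oV hcover fun x hxU hxV => ?_⟩
      have hx := congrArg (fun o : SmoothOrientation I ↥(U ⊓ V) => o ⟨x, hxU, hxV⟩) h
      simp only [SmoothOrientation.restrictLE_apply] at hx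
      exact hx.symm
    · refine ⟨SmoothOrientation.glue U V oU (-oV) hcover fun x hxU hxV => ?_⟩
      have hx := congrArg (fun o : SmoothOrientation I ↥(U ⊓ V) => o ⟨x, hxU, hxV⟩) h
      simp only [SmoothOrientation.neg_apply, SmoothOrientation.restrictLE_apply] at hx
      show oU ⟨x, hxU⟩ = -oV ⟨x, hxV⟩
      rw [hx]
      generalize oU ⟨x, _⟩ = a
      exact (neg_neg a).symm

end Cover

/-! ### Polar coordinates: the punctured plane is a cylinder -/

section Polar

/-- **Polar coordinates** `ℝ² ∖ 0 ≅ 𝕊¹ × ℝ`, `w ↦ (w/‖w‖, log ‖w‖)`, with inverse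
`(u, r) ↦ eʳ u`: a diffeomorphism between the punctured plane (open submanifold of `ℝ²`) and
the cylinder (product manifold). [folklore] -/
def polarDiffeomorph : ↥puncturedPlane ≃ₘ⟮𝓘(ℝ, 𝔼 2), (𝓡 1).prod 𝓘(ℝ, ℝ)⟯ (↥(𝕊 1) × ℝ) where
  toFun w := (fibreAngle w, Real.log ‖(w : 𝔼 2)‖)
  invFun p := ⟨Real.exp p.2 • ((p.1 : 𝕊 1) : 𝔼 2),
    mem_puncturedPlane.2 (smul_ne_zero (Real.exp_pos _).ne' (ne_zero_of_mem_unit_sphere _))⟩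
  left_inv w := by
    have hw : (w : 𝔼 2) ≠ 0 := w.2
    apply Subtype.ext
    show Real.exp (Real.log ‖(w : 𝔼 2)‖) • ((fibreAngle w : 𝕊 1) : 𝔼 2) = w
    rw [Real.exp_log (norm_pos_iff.2 hw), coe_fibreAngle, smul_smul,
      mul_inv_cancel₀ (norm_ne_zero_iff.2 hw), one_smul]
  right_inv p := by
    obtain ⟨u, r⟩ := p
    have hn : ‖Real.exp r • ((u : 𝕊 1) : 𝔼 2)‖ = Real.exp r := by
      rw [norm_smul, norm_eq_of_mem_sphere, mul_one, Real.norm_eq_abs, abs_of_pos (Real.exp_pos r)]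
    refine Prod.ext (Subtype.ext ?_) ?_
    · show ‖Real.exp r • ((u : 𝕊 1) : 𝔼 2)‖⁻¹ • (Real.exp r • ((u : 𝕊 1) : 𝔼 2)) = u
      rw [hn, smul_smul, inv_mul_cancel₀ (Real.exp_pos r).ne', one_smul]
    · show Real.log ‖Real.exp r • ((u : 𝕊 1) : 𝔼 2)‖ = r
      rw [hn, Real.log_exp]
  contMDiff_toFun := by
    refine contMDiff_fibreAngle.prodMk ?_
    have hs : ContDiffOn ℝ ∞ (fun w : 𝔼 2 => Real.log ‖w‖) {w | w ≠ 0} := fun w hw =>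
      ((contDiffAt_norm ℝ hw).log (norm_ne_zero_iff.2 hw)).contDiffWithinAt
    exact hs.contMDiffOn.comp_contMDiff contMDiff_subtype_val fun w => w.2
  contMDiff_invFun := by
    haveI : Fact (Module.finrank ℝ (𝔼 2) = 1 + 1) := ⟨by simp⟩
    refine (ContMDiff.subtypeVal_comp_iff puncturedPlane _).1 ?_
    have h1 : ContMDiff ((𝓡 1).prod 𝓘(ℝ, ℝ)) 𝓘(ℝ, ℝ) ∞ fun p : ↥(𝕊 1) × ℝ => Real.exp p.2 :=
      Real.contDiff_exp.comp_contMDiff contMDiff_snd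
    have h2 : ContMDiff ((𝓡 1).prod 𝓘(ℝ, ℝ)) 𝓘(ℝ, 𝔼 2) ∞ fun p : ↥(𝕊 1) × ℝ => ((p.1 : 𝕊 1) : 𝔼 2) :=
      contMDiff_coe_sphere.comp contMDiff_fst
    exact h1.smul h2

/-- **The punctured plane is orientable** (an open submanifold of the orientable `ℝ²`).
[folklore] -/
theorem isOrientable_puncturedPlane : IsOrientable 𝓘(ℝ, 𝔼 2) ↥puncturedPlane :=
  (isOrientable_of_simplyConnectedSpace_holds (I := 𝓘(ℝ, 𝔼 2)) (M := 𝔼 2)).opens puncturedPlane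

end Polar

/-! ### Orientability of the capped surface -/

section Cap

variable {S : Type} [TopologicalSpace S] [ChartedSpace (EuclideanHalfSpace 2) S]
  [IsManifold (𝓡∂ 2) ∞ S] (c : CapData S)

namespace CapData

/-- The boundary circle is connected (it is diffeomorphic to the circle). [folklore] -/
theorem connectedSpace_boundary (c : CapData S) : ConnectedSpace ((𝓡∂ 2).boundary S) :=
  connectedSpace_of_homeomorph_sphere_one c.φS.toHomeomorph

/-- **The interior of an orientable manifold with boundary is orientable** (pull back along the
interior inclusion, a codimension-`0` smooth embedding). [folklore] -/
theorem isOrientable_interior {M : Type*} [TopologicalSpace M] [ChartedSpace (EuclideanHalfSpace 2) M]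
    [IsManifold (𝓡∂ 2) ∞ M] (h : IsOrientable (𝓡∂ 2) M) :
    IsOrientable 𝓘(ℝ, 𝔼 2) (InteriorManifold (𝓡∂ 2) M) :=
  IsOrientable.of_isSmoothEmbedding InteriorManifold.isSmoothEmbedding_val h

/-- **The cylinder piece of the first gluing is orientable**: `inl (∂S × ℝ) ⊆ X` is
diffeomorphic, through `∂S × ℝ ≅ 𝕊¹ × ℝ`, to the punctured plane (polar coordinates), with the
same model vector space `ℝ²` at both ends. [folklore] -/
theorem isOrientable_range_d₁_inl :
    IsOrientable 𝓘(ℝ, 𝔼 2) ↥(rangeOpens c.G.d₁.inl c.G.d₁.isOpen_range_inl) := by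
  have Φ : ↥puncturedPlane ≃ₘ⟮𝓘(ℝ, 𝔼 2), 𝓘(ℝ, 𝔼 2)⟯
      ↥(rangeOpens c.G.d₁.inl c.G.d₁.isOpen_range_inl) :=
    polarDiffeomorph.trans ((c.φS.symm.prodCongr (Diffeomorph.refl 𝓘(ℝ, ℝ) ℝ ∞)).trans
      (rangeDiffeomorph c.G.d₁.isSmoothEmbedding_inl c.G.d₁.isOpen_range_inl))
  exact isOrientable_puncturedPlane.of_diffeomorph Φ (by simp)

/-- **The interior piece of the first gluing is orientable** (diffeomorphic to `S ∖ ∂S`).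
[folklore] -/
theorem isOrientable_range_d₁_inr (ho : IsOrientable (𝓡∂ 2) S) :
    IsOrientable 𝓘(ℝ, 𝔼 2) ↥(rangeOpens c.G.d₁.inr c.G.d₁.isOpen_range_inr) :=
  (isOrientable_interior ho).of_diffeomorph
    (rangeDiffeomorph c.G.d₁.isSmoothEmbedding_inr c.G.d₁.isOpen_range_inr) (by simp)

/-- The overlap of the two pieces of the first gluing is `inl (∂S × (0, ∞))`. [folklore] -/
theorem range_d₁_inl_inter_range_d₁_inr :
    range c.G.d₁.inl ∩ range c.G.d₁.inr = c.G.d₁.inl '' {p | 0 < p.2} := by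
  ext x
  constructor
  · rintro ⟨⟨p, rfl⟩, hx⟩
    exact ⟨p, c.G.d₁.inl_mem_range_inr_iff.1 hx, rfl⟩
  · rintro ⟨p, hp, rfl⟩
    exact ⟨mem_range_self _, c.G.d₁.inl_mem_range_inr_iff.2 hp⟩

/-- **The first glued manifold `X = (∂S × ℝ) ∪ (S ∖ ∂S)` is orientable** for orientable `S`
(two orientable open pieces with connected overlap `∂S × (0, ∞)`). [cite: HirschDT1976, Ch. 4 §4] -/
theorem isOrientable_X (ho : IsOrientable (𝓡∂ 2) S) : IsOrientable 𝓘(ℝ, 𝔼 2) c.G.d₁.Glued := by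
  haveI := c.connectedSpace_boundary
  refine IsOrientable.of_opens_cover_of_isPreconnected
    (rangeOpens c.G.d₁.inl c.G.d₁.isOpen_range_inl) (rangeOpens c.G.d₁.inr c.G.d₁.isOpen_range_inr)
    (fun x => (eq_univ_iff_forall.1 c.G.d₁.range_inl_union_range_inr x).elim Or.inl Or.inr)
    c.isOrientable_range_d₁_inl (c.isOrientable_range_d₁_inr ho) ?_
  show IsPreconnected (range c.G.d₁.inl ∩ range c.G.d₁.inr)
  rw [c.range_d₁_inl_inter_range_d₁_inr]
  refine IsPreconnected.image ?_ _ c.G.d₁.continuous_inl.continuousOn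
  have : {p : (BoundaryManifold.boundaryData 1 S).carrier × ℝ | 0 < p.2} = univ ×ˢ Ioi 0 := by
    ext p
    exact ⟨fun h => ⟨trivial, h⟩, fun h => h.2⟩
  rw [this]
  haveI : ConnectedSpace (BoundaryManifold.boundaryData 1 S).carrier := c.connectedSpace_boundary
  exact isPreconnected_univ.prod isPreconnected_Ioi

variable [Nonempty ((𝓡∂ 2).boundary S)]

/-- The overlap of the two pieces of the second gluing is `inl (inl (∂S × (-∞, 0)))`.
[folklore] -/
theorem range_d₂_inl_inter_range_d₂_inr :
    range c.G.d₂.inl ∩ range c.G.d₂.inr = (c.G.d₂.inl ∘ c.G.d₁.inl) '' {p | p.2 < 0} := by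
  ext x
  constructor
  · rintro ⟨⟨y, rfl⟩, hx⟩
    have hy : y ∈ c.G.glue₂.source := by
      have := c.G.d₂.inl_mem_range_inr_iff.1 hx
      rwa [c.G.d₂_glue] at this
    obtain ⟨p, hp, rfl⟩ := c.G.mem_glue₂_source_iff.1 hy
    exact ⟨p, hp, rfl⟩
  · rintro ⟨p, hp, rfl⟩
    refine ⟨mem_range_self _, c.G.d₂.inl_mem_range_inr_iff.2 ?_⟩
    rw [c.G.d₂_glue]
    exact c.G.inl_mem_glue₂_source_iff.2 hp

/-- **The capped surface `P = S ∪_φ 𝔻²` of an orientable surface is orientable** (Hirsch, Ch. 9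
§3, proof of Thm. 3.7; Kosinski VI.(1.1)): the open pieces `X` and `𝔻² ∖ ∂𝔻²` are orientable and
meet in the connected `∂S × (-∞, 0)`. [cite: HirschDT1976, Ch. 9 §3, Thm. 3.7] -/
theorem isOrientable_P [T2Space S] [CompactSpace S] (ho : IsOrientable (𝓡∂ 2) S) :
    IsOrientable 𝓘(ℝ, 𝔼 2) c.P := by
  haveI := c.connectedSpace_boundary
  haveI : ContractibleSpace (𝔻 2) := Metric.contractibleSpace_closedBall zero_le_one
  have hD : IsOrientable (𝓡∂ 2) (𝔻 2) := isOrientable_of_simplyConnectedSpace_holds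
  have hU : IsOrientable 𝓘(ℝ, 𝔼 2) ↥(rangeOpens c.G.d₂.inl c.G.d₂.isOpen_range_inl) :=
    (c.isOrientable_X ho).of_diffeomorph
      (rangeDiffeomorph c.G.d₂.isSmoothEmbedding_inl c.G.d₂.isOpen_range_inl) (by simp)
  have hV : IsOrientable 𝓘(ℝ, 𝔼 2) ↥(rangeOpens c.G.d₂.inr c.G.d₂.isOpen_range_inr) :=
    (isOrientable_interior hD).of_diffeomorph
      (rangeDiffeomorph c.G.d₂.isSmoothEmbedding_inr c.G.d₂.isOpen_range_inr) (by simp)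
  refine IsOrientable.of_opens_cover_of_isPreconnected
    (rangeOpens c.G.d₂.inl c.G.d₂.isOpen_range_inl) (rangeOpens c.G.d₂.inr c.G.d₂.isOpen_range_inr)
    (fun x => (eq_univ_iff_forall.1 c.G.d₂.range_inl_union_range_inr x).elim Or.inl Or.inr)
    hU hV ?_
  show IsPreconnected (range c.G.d₂.inl ∩ range c.G.d₂.inr)
  rw [c.range_d₂_inl_inter_range_d₂_inr]
  refine IsPreconnected.image ?_ _ (c.G.d₂.continuous_inl.comp c.G.d₁.continuous_inl).continuousOn
  have : {p : (BoundaryManifold.boundaryData 1 S).carrier × ℝ | p.2 < 0} = univ ×ˢ Iio 0 := by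
    ext p
    exact ⟨fun h => ⟨trivial, h⟩, fun h => h.2⟩
  rw [this]
  haveI : ConnectedSpace (BoundaryManifold.boundaryData 1 S).carrier := c.connectedSpace_boundary
  exact isPreconnected_univ.prod isPreconnected_Iio

end CapData

end Cap

end Literature.Topology.FourManifolds
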